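/-
COR-CM (cell pub-hodgecm2 = stage 2 of the Hodge ladder), seat b26 gen 20 (prover-pub-hodgecm2-b26-g20-0, 2026-08-21);
count-neutral for the binder table (no row).  Lane CM-FIELD-POWERS, part 10: the CENTRE of `End⁰(X)` —
`Z(End⁰(X)) ≅ ∏ᵢ Z(End⁰ Bᵢ)`, for CM `X` a product of CM fields of total degree `Σᵢ 2 dim Bᵢ`.  Theorems only.
-/
import Summits.HodgeConjecture.CorCM.EndAlgebraStructure
import Mathlib.Algebra.Algebra.Subalgebra.Pi
import HarnessLib

/-!
# The centre of `End⁰(X)`: `Z(End⁰(⨁ᵢ Bᵢ^{nᵢ+1})) ≅ ∏ᵢ Z(End⁰ Bᵢ)`; for CM `X`, `dim_ℚ Z(End⁰ X) = Σᵢ 2 dim Bᵢ`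

D. Mumford, *Abelian Varieties* (1970), §19 p. 174 (`End⁰(X) = ⊕ᵢ M_{nᵢ}(Dᵢ)`, so the centre of
`End⁰(X)` is `⊕ᵢ Kᵢ`, `Kᵢ` the centre of `Dᵢ`); G. Shimura, *Abelian Varieties with Complex Multiplication
and Modular Functions* (1998), §5.1 Proposition 4 (proof: «`K` is the center of `End_Q(A)`») and
Proposition 6 (`End_Q(B) = K` for simple CM `B` in characteristic `0`).  On the tree's carriers, for a
finite ORTHOGONAL family `B` over any field and `X = ⨁ᵢ ⨁_{Fin (nᵢ+1)} Bᵢ`: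

* `exists_algEquiv_center_pi` — `Z(∏ᵢ Rᵢ) ≃ₐ[ℚ] ∏ᵢ Z(Rᵢ)` (Mathlib `Subalgebra.center_pi`, packaged);
* `finrank_center_endAlgebra_biproduct_eq_sum` — `dim_ℚ Z(End⁰(⨁ A)) = Σᵢ dim_ℚ Z(End⁰(A i))` for an
  orthogonal family `A`;
* `finrank_center_endAlgebra_biproduct_powers` — `dim_ℚ Z(End⁰(X)) = Σᵢ dim_ℚ Z(End⁰(Bᵢ))`
  (`Z(Mat_m(D)) = Z(D)`, `CorCM/EndAlgebraPowerMatrix`);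
and over `ℂ`:
* `finrank_center_endAlgebra_of_isIsogenous_cmPowers` — for `A ∼ X` with `Bᵢ` simple CM pairwise
  non-isogenous, `dim_ℚ Z(End⁰(A)) = Σᵢ 2 dim Bᵢ`;
* `IsOfCMType.exists_center_structure` — for every complex `X` of CM-type: `dim_ℚ Z(End⁰ X) = Σᵢ 2 dim Bᵢ`
  and `2 dim X = Σᵢ (nᵢ+1) · 2 dim Bᵢ` in its isotypic decomposition; in particular
  `dim_ℚ Z(End⁰ X) ≤ 2 dim X` with equality iff `End⁰(X)` is commutative
  (`finrank_center_le_two_mul_dim`, `finrank_center_eq_two_mul_dim_iff_comm`).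

## References
* [MumfordAV1970] D. Mumford, *Abelian Varieties* (1970), §19 (p. 174).
* [Shimura1998] G. Shimura, *Abelian Varieties with Complex Multiplication and Modular Functions* (1998),
  §5.1 Propositions 4 and 6 (held chunks p0048–p0050).
-/

noncomputable section

open CategoryTheory CategoryTheory.Limits

namespace Summit.HodgeConjecture.CorCM.CMProductEnd

open Literature.AlgebraicGeometry.Motives Literature.AlgebraicGeometry.Motives.AbelianVariety
open Literature.AlgebraicGeometry.ComplexMultiplication
open Literature.AlgebraicGeometry.Milne1999 (IsOfCMType IsOfCMTypeSimple)
open Summit.HodgeConjecture.CorCM.AndreRiemann Summit.HodgeConjecture.CorCM.EndAlgebraPower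
open Summit.HodgeConjecture.CorCM.IsotypicCM

universe u

/-! ## §1 The centre of a finite product of algebras -/

/-- **`Z(∏ᵢ Rᵢ) ≅ ∏ᵢ Z(Rᵢ)`** as `ℚ`-algebras (Mathlib `Subalgebra.center_pi`, packaged as an
isomorphism). [folklore] -/
theorem exists_algEquiv_center_pi {ι : Type} [Fintype ι] (R : ι → Type u) [∀ i, Ring (R i)]
    [∀ i, Algebra ℚ (R i)] :
    Nonempty (Subalgebra.center ℚ (∀ i, R i) ≃ₐ[ℚ] ∀ i, Subalgebra.center ℚ (R i)) := by
  have hmem : ∀ (z : ∀ i, R i), z ∈ Subalgebra.center ℚ (∀ i, R i) ↔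
      ∀ i, z i ∈ Subalgebra.center ℚ (R i) := fun z => by
    rw [Subalgebra.center_pi, Subalgebra.mem_pi]
    exact ⟨fun h i => h i (Set.mem_univ i), fun h i _ => h i⟩
  exact ⟨
    { toFun := fun z i => ⟨z.1 i, (hmem z.1).1 z.2 i⟩
      invFun := fun y => ⟨fun i => (y i).1, (hmem _).2 fun i => (y i).2⟩
      left_inv := fun z => rfl
      right_inv := fun y => rfl
      map_mul' := fun z w => rfl
      map_add' := fun z w => rfl
      commutes' := fun q => rfl }⟩

/-- `dim_ℚ Z(∏ᵢ Rᵢ) = Σᵢ dim_ℚ Z(Rᵢ)` for finite-dimensional `ℚ`-algebras `Rᵢ`. [folklore] -/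
theorem finrank_center_pi {ι : Type} [Fintype ι] (R : ι → Type u) [∀ i, Ring (R i)]
    [∀ i, Algebra ℚ (R i)] [∀ i, Module.Finite ℚ (R i)] :
    Module.finrank ℚ (Subalgebra.center ℚ (∀ i, R i)) =
      ∑ i, Module.finrank ℚ (Subalgebra.center ℚ (R i)) := by
  obtain ⟨e⟩ := exists_algEquiv_center_pi R
  haveI : ∀ i, Module.Finite ℚ (Subalgebra.center ℚ (R i)) := fun i =>
    Module.Finite.of_injective (Subalgebra.center ℚ (R i)).val.toLinearMap Subtype.val_injective
  haveI : ∀ i, Module.Free ℚ (Subalgebra.center ℚ (R i)) := fun i => Module.Free.of_divisionRing ℚ _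
  rw [e.toLinearEquiv.finrank_eq, Module.finrank_pi_fintype]

/-! ## §2 Any field: the centre of `End⁰` of an orthogonal biproduct (of powers) -/

section AnyField

variable {k : Type u} [Field k] {ι : Type} [Fintype ι] [DecidableEq ι]

/-- **`dim_ℚ Z(End⁰(⨁ A)) = Σᵢ dim_ℚ Z(End⁰(A i))` for an orthogonal family `A`**
(`End⁰(⨁ A) ≅ ∏ End⁰(A i)`, centres correspond). [cite: MumfordAV1970, §19 (p. 174)] -/
theorem finrank_center_endAlgebra_biproduct_eq_sum {A : ι → AbelianVariety k}
    (horth : ∀ j l, j ≠ l → ∀ f : A j ⟶ A l, f = 0) :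
    Module.finrank ℚ (Subalgebra.center ℚ (⨁ A).endAlgebra) =
      ∑ i, Module.finrank ℚ (Subalgebra.center ℚ (A i).endAlgebra) := by
  obtain ⟨e, -⟩ := nonempty_algEquiv_endAlgebra_biproduct_pi horth
  haveI : ∀ i, Module.Finite ℚ (A i).endAlgebra := fun i => finiteDimensional_endAlgebra_holds (A i)
  rw [(center_transfer_algEquiv e).1, finrank_center_pi]

/-- **`dim_ℚ Z(End⁰(⨁ᵢ Bᵢ^{nᵢ+1})) = Σᵢ dim_ℚ Z(End⁰(Bᵢ))`** for an orthogonal family `B`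
(`Z(Mat_m(D)) ≅ Z(D)`, the tree's `finrank_center_endAlgebra_biproduct`).
[cite: MumfordAV1970, §19 (p. 174)] [cite: Shimura1998, §5.1 Proposition 4 (proof)] -/
theorem finrank_center_endAlgebra_biproduct_powers {B : ι → AbelianVariety k} {n : ι → ℕ}
    (horth : ∀ j l, j ≠ l → ∀ f : B j ⟶ B l, f = 0) :
    Module.finrank ℚ (Subalgebra.center ℚ (⨁ fun i => ⨁ fun _ : Fin (n i + 1) => B i).endAlgebra) =
      ∑ i, Module.finrank ℚ (Subalgebra.center ℚ (B i).endAlgebra) := by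
  rw [finrank_center_endAlgebra_biproduct_eq_sum (orthogonal_biproduct_powers horth)]
  exact Finset.sum_congr rfl fun i _ => finrank_center_endAlgebra_biproduct (Nat.succ_pos (n i))

end AnyField

/-! ## §3 Over `ℂ`: the centre of `End⁰` of a CM abelian variety -/

section Complex

variable {r : ℕ} {B : Fin r → AbelianVariety ℂ} {n : Fin r → ℕ} {A : AbelianVariety ℂ}

/-- **`dim_ℚ Z(End⁰(A)) = Σᵢ 2 dim Bᵢ`** for `A ∼ ⨁ᵢ Bᵢ^{nᵢ+1}` with `Bᵢ` pairwise non-isogenous and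
`End⁰(Bᵢ)` a field of degree `2 dim Bᵢ` (the centre is `⊕ᵢ Kᵢ`, Shimura Prop. 4 «`K` is the center
of `End_Q(A)`» blockwise). [cite: Shimura1998, §5.1 Propositions 4 and 6] [cite: MumfordAV1970, §19 (p. 174)] -/
theorem finrank_center_endAlgebra_of_isIsogenous_cmPowers (hB : ∀ i, IsOfCMTypeSimple (B i))
    (hni : ∀ j l, j ≠ l → ¬ IsIsogenous (B j) (B l))
    (hA : IsIsogenous A (⨁ fun i => ⨁ fun _ : Fin (n i + 1) => B i)) :
    Module.finrank ℚ (Subalgebra.center ℚ A.endAlgebra) = ∑ i, 2 * (B i).dim := by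
  obtain ⟨e⟩ := hA.nonempty_endAlgebra_algEquiv
  rw [(center_transfer_algEquiv e).1,
    finrank_center_endAlgebra_biproduct_eq_sum
      (orthogonal_biproduct_powers (orthogonal_of_isOfCMTypeSimple hB hni))]
  refine Finset.sum_congr rfl fun i _ => ?_
  rw [(isField_center_endAlgebra_biproduct (Nat.succ_pos (n i)) (hB i).1).2, (hB i).2]

/-- **The centre of `End⁰` of a complex abelian variety of CM-type**: in the isotypic decomposition
`X ∼ ⨁ᵢ Bᵢ^{nᵢ+1}` (`Bᵢ` simple CM pairwise non-isogenous), `dim_ℚ Z(End⁰ X) = Σᵢ 2 dim Bᵢ` while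
`2 dim X = Σᵢ (nᵢ+1) · 2 dim Bᵢ` and `dim_ℚ End⁰(X) = Σᵢ (nᵢ+1)² · 2 dim Bᵢ`.
[cite: Shimura1998, §5.1 Propositions 4 and 6] [cite: MumfordAV1970, §19 (p. 174)] -/
theorem IsOfCMType.exists_center_structure {X : AbelianVariety ℂ} (hX : IsOfCMType X) :
    ∃ (r : ℕ) (B : Fin r → AbelianVariety ℂ) (n : Fin r → ℕ),
      (∀ i, IsOfCMTypeSimple (B i)) ∧ (∀ i j, i ≠ j → ¬ IsIsogenous (B i) (B j)) ∧
      IsIsogenous X (⨁ fun i => ⨁ fun _ : Fin (n i + 1) => B i) ∧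
      2 * X.dim = ∑ i, (n i + 1) * (2 * (B i).dim) ∧
      Module.finrank ℚ (Subalgebra.center ℚ X.endAlgebra) = ∑ i, 2 * (B i).dim ∧
      Module.finrank ℚ X.endAlgebra = ∑ i, (n i + 1) ^ 2 * (2 * (B i).dim) := by
  obtain ⟨r, B, n, -, hBcm, hni, hXT, hdim, hfin, -, -⟩ := IsOfCMType.exists_endAlgebra_structure hX
  refine ⟨r, B, n, hBcm, hni, hXT, ?_, finrank_center_endAlgebra_of_isIsogenous_cmPowers hBcm hni hXT, hfin⟩
  rw [hdim, Finset.mul_sum]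
  exact Finset.sum_congr rfl fun i _ => by ring

/-- **`dim_ℚ Z(End⁰ X) ≤ 2 dim X` for `X` of CM-type** (`Σ 2 dim Bᵢ ≤ Σ (nᵢ+1) 2 dim Bᵢ`).
[cite: Shimura1998, §5.1 Propositions 4 and 6] -/
theorem finrank_center_le_two_mul_dim {X : AbelianVariety ℂ} (hX : IsOfCMType X) :
    Module.finrank ℚ (Subalgebra.center ℚ X.endAlgebra) ≤ 2 * X.dim := by
  obtain ⟨r, B, n, -, -, -, hdim, hZ, -⟩ := IsOfCMType.exists_center_structure hX
  rw [hZ, hdim]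
  exact Finset.sum_le_sum fun i _ => by nlinarith [Nat.zero_le (n i), Nat.zero_le ((B i).dim)]

/-- **For `X` of CM-type: `dim_ℚ Z(End⁰ X) = 2 dim X` iff `End⁰(X)` is commutative** (iff all
multiplicities are one; then `Z(End⁰ X) = End⁰(X) = ⊕ᵢ Kᵢ`). [cite: Shimura1998, §5.1 Propositions 4 and 6]
[cite: MumfordAV1970, §19 (p. 174)] -/
theorem finrank_center_eq_two_mul_dim_iff_comm {X : AbelianVariety ℂ} (hX : IsOfCMType X) :
    Module.finrank ℚ (Subalgebra.center ℚ X.endAlgebra) = 2 * X.dim ↔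
      ∀ x y : X.endAlgebra, x * y = y * x := by
  obtain ⟨r, B, n, hS, hBcm, hni, hXT, hdimX, -, hcomm, -⟩ := IsOfCMType.exists_endAlgebra_structure hX
  have hd : ∀ i, 0 < (B i).dim := fun i => dim_pos_of_isOfCMTypeSimple (hBcm i)
  rw [hcomm, finrank_center_endAlgebra_of_isIsogenous_cmPowers hBcm hni hXT, hdimX, Finset.mul_sum]
  constructor
  · intro h
    have hle : ∀ i ∈ Finset.univ, 2 * (B i).dim ≤ 2 * ((n i + 1) * (B i).dim) :=
      fun i _ => by nlinarith [Nat.zero_le (n i), Nat.zero_le ((B i).dim)]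
    have heq := (Finset.sum_eq_sum_iff_of_le hle).1 h
    intro i
    have hi := heq i (Finset.mem_univ i)
    have hdi := hd i
    by_contra hni0
    have h1 : 1 ≤ n i := Nat.one_le_iff_ne_zero.2 hni0
    nlinarith
  · intro h
    exact Finset.sum_congr rfl fun i _ => by rw [h i]; ring

end Complex

end Summit.HodgeConjecture.CorCM.CMProductEnd

end
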